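import Literature.NumberTheory.Automorphic.CuspidalRepDataOfCuspForm
import Literature.NumberTheory.Automorphic.AutomorphicRepLieActionEnvelope
import Literature.NumberTheory.Automorphic.AutomorphicRepsGLCuspidalQuasiSimple
import Literature.NumberTheory.Automorphic.CentralDerivativesTranslationGLComponents
import Literature.NumberTheory.Automorphic.AutomorphicFormsTranslates
import Literature.NumberTheory.Automorphic.ArchimedeanEnvelopingAction
import HarnessLib

/-!
# The infinitesimal character of the cuspidal automorphic representation generated by a
# `Z(𝔤)`-eigenform, by cyclicity (Langlands 1979, proof of Prop. 2; Borel–Jacquet 1979, 4.6)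

Topic `NumberTheory/Automorphic`; theorems only (no definition, no named fact). For a non-zero cusp
form `φ ∈ 𝒜₀(GL_n(K) \ GL_n(𝔸_K))` on which the centre `Z(𝔤)` of `U(𝔤𝔩_n(K_∞))` acts through a
character `θ` (`HasZCharacter`, e.g. the adelic lift of a holomorphic eigenform, or any function with
Casimir and central eigenvalues on `GL₂(𝔸_ℚ)`, `Rat.hasZCharacter_of_casimir_of_zed`), the cuspidal
automorphic representation datum `π_φ = W / W'` GENERATED by `φ`
(`CuspidalAutomorphicRepData.ofCuspForm`: `W` the stable closure of `φ`) has infinitesimal character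
`θ` — WITHOUT any irreducibility / admissibility / Schur-lemma input: the cusp forms with
`Z(𝔤)`-character `θ` form a `(𝔤, K_∞) × GL_n(𝔸_K^∞)`-stable space (central words commute with Lie
derivatives and with right translations by `K_∞` and by the finite adeles), so it contains the
stable closure `W` of `φ` (minimality, `W_ofCuspForm_le`), and `Z(𝔤)` acts on `W / W'` through its
word action on `W`.

* `HasZCharacter.rightTranslation_of_mem_finiteAdelic_gl`, `HasZCharacter.rightTranslation_ofK_gl`,
  `HasZCharacter.lieDeriv_gl` — the three stabilities of the `Z(𝔤)`-character condition on smooth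
  functions on `GL_n(𝔸_K)`.
* `CuspidalAutomorphicRepData.hasZCharacter_of_mem_W_ofCuspForm` — **every form of the datum
  generated by a `θ`-eigen cusp form is `θ`-eigen**.
* `AutomorphicRepData.coe_lift_lieRepW_freeToEnveloping` — the enveloping action on `W` is the
  word action on functions; `AutomorphicRepData.hasInfinitesimalCharacter_lieRep_of_forall_hasZCharacter`
  — a datum all of whose forms are `θ`-eigen has infinitesimal character `θ` (for the Lie action
  `π.lieRep`); whence
* `CuspidalAutomorphicRepData.hasInfinitesimalCharacter_ofCuspForm` — **the generated datum has
  infinitesimal character `θ`**.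

## References

* R. P. Langlands, *On the notion of an automorphic representation*, Corvallis 1979, proof of
  Prop. 2 [LanglandsCorvallis1979Notion].
* A. Borel, H. Jacquet, *Automorphic forms and automorphic representations*, Corvallis 1979, §1.6,
  4.3 (ii), 4.6 [BorelJacquet1979].
-/

-- Mathlib idiom (Mathlib/Algebra/Lie/OfAssociative.lean): the commutator bracket on associative algebras.
attribute [local instance 100] LieRing.ofAssociativeRing

noncomputable section

open scoped MatrixGroups Matrix Classical
open NumberField NumberField.mixedEmbedding IsDedekindDomain UniversalEnvelopingAlgebra

namespace Literature.NumberTheory.Automorphic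

/-! ### Stabilities of the `Z(𝔤)`-character condition on `GL_n(𝔸_K)` -/

section Stability

variable {n : ℕ} {K : Type} [Field K] [NumberField K] {hcpt : isCompact_glFiniteIntegralLevel n K}
  {θ : centerU (AutomorphyDatum.gl n K hcpt).arch →ₐ[ℝ] ℂ}

/-- **Right translation by a finite adele preserves the `Z(𝔤)`-character**: `G(𝔸_f)` commutes with
`G_∞` (`commute_ofArch`), so the word action commutes with `r(h)` (`applyFree_comp_mul_right`).
Borel–Jacquet 1979, 4.3 (ii). [cite: BorelJacquet1979, 4.3 (ii)] -/
theorem HasZCharacter.rightTranslation_of_mem_finiteAdelic_gl {φ : (AdelicGroupData.gl n K).Adelic → ℂ}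
    (hφ : HasZCharacter (AutomorphyDatum.gl n K hcpt).ofArch φ θ) {h : (AdelicGroupData.gl n K).Adelic}
    (hh : h ∈ (AutomorphyDatum.gl n K hcpt).finiteAdelic) :
    HasZCharacter (AutomorphyDatum.gl n K hcpt).ofArch (rightTranslation (AdelicGroupData.gl n K) h φ) θ := by
  intro p hp
  have hcomm : ∀ a : (AutomorphyDatum.gl n K hcpt).arch.carrier,
      (AutomorphyDatum.gl n K hcpt).ofArch a * h = h * (AutomorphyDatum.gl n K hcpt).ofArch a :=
    fun a => (AutomorphyDatum.gl n K hcpt).commute_ofArch a h hh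
  have key := applyFree_comp_mul_right (AutomorphyDatum.gl n K hcpt).ofArch p φ hcomm
  change applyFree (AutomorphyDatum.gl n K hcpt).ofArch p (fun g => φ (g * h)) =
    θ ⟨freeToEnveloping _ p, hp⟩ • fun g => φ (g * h)
  rw [key, hφ p hp]
  rfl

/-- **Right translation by `K_∞` preserves the `Z(𝔤)`-character** of a smooth function: central
words commute with right translation by every element of `GL_n(K_∞)`
(`applyFree_archTranslate_of_isCentralWord`). Borel–Jacquet 1979, 4.3 (ii); Borel 1997, 2.5.
[cite: BorelJacquet1979, 4.3 (ii)] -/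
theorem HasZCharacter.rightTranslation_ofK_gl {φ : (AdelicGroupData.gl n K).Adelic → ℂ}
    (hφs : IsArchSmooth (AutomorphyDatum.gl n K hcpt).ofArch φ)
    (hφ : HasZCharacter (AutomorphyDatum.gl n K hcpt).ofArch φ θ)
    (k : (AutomorphyDatum.gl n K hcpt).arch.maximalCompact) :
    HasZCharacter (AutomorphyDatum.gl n K hcpt).ofArch
      (rightTranslation (AdelicGroupData.gl n K) ((AutomorphyDatum.gl n K hcpt).ofK k) φ) θ := by
  intro p hp
  have h1 := applyFree_archTranslate_of_isCentralWord (AutomorphyDatum.gl n K hcpt).ofArch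
    (archGroupGL_lie n K) (archGroupGL_carrier n K)
    (Subgroup.inclusion (AutomorphyDatum.gl n K hcpt).arch.maximalCompact_le_carrier k) hp hφs
  have h2 := congrArg (archTranslate (AutomorphyDatum.gl n K hcpt).ofArch
    (Subgroup.inclusion (AutomorphyDatum.gl n K hcpt).arch.maximalCompact_le_carrier k)) (hφ p hp)
  rw [map_smul] at h2
  exact h1.trans h2

/-- **Lie derivatives preserve the `Z(𝔤)`-character** of a smooth function: central words commute
with Lie derivatives (`applyFree_lieDeriv_of_isCentralWord`). Borel–Jacquet 1979, §1.6 and 4.3 (ii).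
[cite: BorelJacquet1979, 4.3 (ii)] -/
theorem HasZCharacter.lieDeriv_gl {φ : (AdelicGroupData.gl n K).Adelic → ℂ}
    (hφs : IsArchSmooth (AutomorphyDatum.gl n K hcpt).ofArch φ)
    (hφ : HasZCharacter (AutomorphyDatum.gl n K hcpt).ofArch φ θ)
    (X : (AutomorphyDatum.gl n K hcpt).arch.lie) :
    HasZCharacter (AutomorphyDatum.gl n K hcpt).ofArch
      (lieDeriv (AutomorphyDatum.gl n K hcpt).ofArch X φ) θ := by
  intro p hp
  have h1 := applyFree_lieDeriv_of_isCentralWord (ι := (AutomorphyDatum.gl n K hcpt).ofArch)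
    (archGroupGL_lie n K) (archGroupGL_carrier n K) hp X hφs
  have h2 := congrArg (lieDeriv (AutomorphyDatum.gl n K hcpt).ofArch X) (hφ p hp)
  rw [lieDeriv_smul] at h2
  exact h1.trans h2

end Stability

/-! ### The datum generated by a `θ`-eigen cusp form consists of `θ`-eigen forms -/

namespace CuspidalAutomorphicRepData

variable {n : ℕ} {K : Type} [Field K] [NumberField K] {hcpt : isCompact_glFiniteIntegralLevel n K}
  {φ : (AdelicGroupData.gl n K).Adelic → ℂ} (hφ : φ ∈ cuspFormsGL n K hcpt) (hφ0 : φ ≠ 0)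
  {θ : centerU (AutomorphyDatum.gl n K hcpt).arch →ₐ[ℝ] ℂ}

/-- **Cyclicity: every form of the datum generated by a `θ`-eigen cusp form `φ` is `θ`-eigen.**
The cusp forms `ψ` with `z ψ = θ(z) ψ` for all `z ∈ Z(𝔤)` form a `(𝔤, K_∞) × GL_n(𝔸_K^∞)`-stable
space of automorphic forms (linearity: `HasZCharacter.add_gl/smul_gl`; stabilities:
`HasZCharacter.rightTranslation_of_mem_finiteAdelic_gl`, `HasZCharacter.rightTranslation_ofK_gl`,
`HasZCharacter.lieDeriv_gl`, together with the stability of `𝒜₀`, `isStableSubmodule_cuspFormsGL`)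
containing `φ`; the stable closure `W` of `φ` is contained in it (`W_ofCuspForm_le`).
Langlands 1979, proof of Prop. 2; Borel–Jacquet 1979, 4.6.
[cite: LanglandsCorvallis1979Notion, proof of Prop. 2] [cite: BorelJacquet1979, 4.6] -/
theorem hasZCharacter_of_mem_W_ofCuspForm (hθ : HasZCharacter (AutomorphyDatum.gl n K hcpt).ofArch φ θ)
    {ψ : (AdelicGroupData.gl n K).Adelic → ℂ} (hψ : ψ ∈ (ofCuspForm hφ hφ0).1.W) :
    HasZCharacter (AutomorphyDatum.gl n K hcpt).ofArch ψ θ := by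
  -- the space of `θ`-eigen cusp forms
  have hsm : ∀ {ψ : (AdelicGroupData.gl n K).Adelic → ℂ}, ψ ∈ cuspFormsGL n K hcpt →
      IsArchSmooth (AutomorphyDatum.gl n K hcpt).ofArch ψ := fun hψ =>
    automorphicForms_le_archSmooth _ (cuspFormsGL_le_automorphicForms n K hcpt hψ)
  let S : Submodule ℂ ((AdelicGroupData.gl n K).Adelic → ℂ) :=
    { carrier := {ψ | ψ ∈ cuspFormsGL n K hcpt ∧ HasZCharacter (AutomorphyDatum.gl n K hcpt).ofArch ψ θ}
      add_mem' := fun {a b} ha hb => ⟨add_mem ha.1 hb.1, ha.2.add_gl (hsm ha.1) (hsm hb.1) hb.2⟩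
      zero_mem' := ⟨zero_mem _, hasZCharacter_zero_gl θ⟩
      smul_mem' := fun c a ha => ⟨Submodule.smul_mem _ c ha.1, ha.2.smul_gl c⟩ }
  have hS : IsStableSubmodule (AutomorphyDatum.gl n K hcpt) S :=
    { le_automorphicForms := fun ψ h => cuspFormsGL_le_automorphicForms n K hcpt h.1
      finite_stable := fun h hh ψ hψS =>
        ⟨cuspFormsGL_le_comap_rightTranslation hh hψS.1, hψS.2.rightTranslation_of_mem_finiteAdelic_gl hh⟩
      k_stable := fun k ψ hψS =>
        ⟨cuspFormsGL_le_comap_rightTranslation_ofK k hψS.1, hψS.2.rightTranslation_ofK_gl (hsm hψS.1) k⟩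
      lie_stable := fun X ψ hψS =>
        ⟨(isStableSubmodule_cuspFormsGL hcpt).lie_stable X ψ hψS.1, hψS.2.lieDeriv_gl (hsm hψS.1) X⟩ }
  exact (W_ofCuspForm_le hφ hφ0 hS (show φ ∈ S from ⟨hφ, hθ⟩) hψ).2

end CuspidalAutomorphicRepData

/-! ### From `θ`-eigen forms to the infinitesimal character of `W / W'` -/

namespace AutomorphicRepData

variable {n : ℕ} {K : Type} [Field K] [NumberField K] {hcpt : isCompact_glFiniteIntegralLevel n K}
  (π : AutomorphicRepData (AutomorphyDatum.gl n K hcpt))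

/-- **The enveloping action on `W` is the word action on functions**: for a word `p ∈ ℝ⟨𝔤⟩` and
`w ∈ W`, `(lift π.lieRepW (image of p)) w = p w` as functions on `GL_n(𝔸_K)` (the inclusion
`W ↪ C^∞` intertwines `π.lieRepW` with the Lie derivative representation `lieDerivRep`, on which
`U(𝔤)` acts by words, `coe_envelopingAction_freeToEnveloping`). Borel–Jacquet 1979, §1.5–1.6 and 4.6.
[cite: BorelJacquet1979, 4.6] -/
theorem coe_lift_lieRepW_freeToEnveloping (p : FreeAlgebra ℝ (AutomorphyDatum.gl n K hcpt).arch.lie)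
    (w : π.W) :
    ((lift ℝ π.lieRepW (freeToEnveloping _ p) w : π.W) : (AdelicGroupData.gl n K).Adelic → ℂ) =
      applyFree (AutomorphyDatum.gl n K hcpt).ofArch p w := by
  -- the inclusion `W ↪ archSmooth`
  have hle : π.W ≤ archSmooth (AutomorphyDatum.gl n K hcpt).ofArch :=
    (π.stable.le_automorphicForms).trans (automorphicForms_le_archSmooth _)
  let q : π.W →ₗ[ℂ] archSmooth (AutomorphyDatum.gl n K hcpt).ofArch := Submodule.inclusion hle
  have hq : ∀ (X : (AutomorphyDatum.gl n K hcpt).arch.lie) (v : π.W),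
      lieDerivRep (AutomorphyDatum.gl n K hcpt).ofArch (archGroupGL_lie n K) (archGroupGL_carrier n K) X (q v) =
        q (π.lieRepW X v) := fun X v => Subtype.ext rfl
  have key := lift_apply_intertwine π.lieRepW
    (lieDerivRep (AutomorphyDatum.gl n K hcpt).ofArch (archGroupGL_lie n K) (archGroupGL_carrier n K))
    q hq (freeToEnveloping _ p) w
  have hcoe : ((lift ℝ π.lieRepW (freeToEnveloping _ p) w : π.W) : (AdelicGroupData.gl n K).Adelic → ℂ) =
      ((q (lift ℝ π.lieRepW (freeToEnveloping _ p) w) : archSmooth (AutomorphyDatum.gl n K hcpt).ofArch) :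
        (AdelicGroupData.gl n K).Adelic → ℂ) := rfl
  rw [hcoe, ← key]
  exact coe_envelopingAction_freeToEnveloping (archGroupGL_lie n K) (archGroupGL_carrier n K) p (q w)

/-- **A datum all of whose forms are `θ`-eigen has infinitesimal character `θ`** for its Lie
action `π.lieRep` on `W / W'`: `z [w] = [z w] = [θ(z) w] = θ(z) [w]` (`lift_apply_intertwine` for
`W → W / W'`, `coe_lift_lieRepW_freeToEnveloping`, surjectivity `ℝ⟨𝔤⟩ → U(𝔤)`, `freeToEnveloping_surjective`).
Borel–Jacquet 1979, 4.6. [cite: BorelJacquet1979, 4.6] -/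
theorem hasInfinitesimalCharacter_lieRep_of_forall_hasZCharacter
    {θ : centerU (AutomorphyDatum.gl n K hcpt).arch →ₐ[ℝ] ℂ}
    (h : ∀ ψ ∈ π.W, HasZCharacter (AutomorphyDatum.gl n K hcpt).ofArch ψ θ) :
    Automorphic.HasInfinitesimalCharacter π.lieRep θ := by
  intro z
  obtain ⟨p, hp⟩ := freeToEnveloping_surjective (AutomorphyDatum.gl n K hcpt).arch
    (z : UniversalEnvelopingAlgebra ℝ (AutomorphyDatum.gl n K hcpt).arch.lie)
  have hpc : IsCentralWord p := by
    change freeToEnveloping _ p ∈ centerU (AutomorphyDatum.gl n K hcpt).arch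
    rw [hp]; exact z.2
  have hz : (⟨freeToEnveloping _ p, hpc⟩ : centerU (AutomorphyDatum.gl n K hcpt).arch) = z := Subtype.ext hp
  have hθz : θ ⟨freeToEnveloping _ p, hpc⟩ = θ z := congrArg θ hz
  -- on `W`: `z w = θ(z) w`
  have hW : ∀ w : π.W, lift ℝ π.lieRepW (z : UniversalEnvelopingAlgebra ℝ _) w = θ z • w := by
    intro w
    apply Subtype.ext
    have e1 : ((lift ℝ π.lieRepW (z : UniversalEnvelopingAlgebra ℝ _) w : π.W) :
        (AdelicGroupData.gl n K).Adelic → ℂ) = applyFree (AutomorphyDatum.gl n K hcpt).ofArch p w := by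
      rw [← coe_lift_lieRepW_freeToEnveloping π p w, hp]
    rw [e1, h w w.2 p hpc, hθz, Submodule.coe_smul]
  -- descend to `W / W'`
  apply LinearMap.ext
  intro v
  induction v using Submodule.Quotient.induction_on with
  | H w =>
    have e2 : envelopingAction π.lieRep (z : UniversalEnvelopingAlgebra ℝ _) (π.mkQ w) =
        π.mkQ (lift ℝ π.lieRepW (z : UniversalEnvelopingAlgebra ℝ _) w) :=
      lift_apply_intertwine π.lieRepW π.lieRep π.mkQ (fun X v => π.lieRep_mkQ X v) _ w
    have e3 : algebraMap ℂ (Module.End ℂ π.Quot) (θ z) (π.mkQ w) = θ z • π.mkQ w :=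
      Module.algebraMap_end_apply _ _ _ (θ z) (π.mkQ w)
    exact e2.trans ((congrArg π.mkQ (hW w)).trans ((map_smul π.mkQ _ _).trans e3.symm))

/-- The same, packaged as `π.HasInfinitesimalCharacter θ` (Borel–Jacquet's notion for the datum).
[cite: BorelJacquet1979, 4.6] -/
theorem hasInfinitesimalCharacter_of_forall_hasZCharacter
    {θ : centerU (AutomorphyDatum.gl n K hcpt).arch →ₐ[ℝ] ℂ}
    (h : ∀ ψ ∈ π.W, HasZCharacter (AutomorphyDatum.gl n K hcpt).ofArch ψ θ) :
    π.HasInfinitesimalCharacter θ :=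
  ⟨π.lieRep, π.hasLieAction_lieRep, π.hasInfinitesimalCharacter_lieRep_of_forall_hasZCharacter h⟩

end AutomorphicRepData

namespace CuspidalAutomorphicRepData

variable {n : ℕ} {K : Type} [Field K] [NumberField K] {hcpt : isCompact_glFiniteIntegralLevel n K}
  {φ : (AdelicGroupData.gl n K).Adelic → ℂ} (hφ : φ ∈ cuspFormsGL n K hcpt) (hφ0 : φ ≠ 0)
  {θ : centerU (AutomorphyDatum.gl n K hcpt).arch →ₐ[ℝ] ℂ}

/-- **The cuspidal automorphic representation generated by a `θ`-eigen cusp form has infinitesimal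
character `θ`** (for the Lie action `lieRep` on `W / W'`), unconditionally — by cyclicity, not by
Schur's lemma. Langlands 1979, proof of Prop. 2; Borel–Jacquet 1979, 4.6.
[cite: LanglandsCorvallis1979Notion, proof of Prop. 2] [cite: BorelJacquet1979, 4.6] -/
theorem hasInfinitesimalCharacter_lieRep_ofCuspForm
    (hθ : HasZCharacter (AutomorphyDatum.gl n K hcpt).ofArch φ θ) :
    Automorphic.HasInfinitesimalCharacter (ofCuspForm hφ hφ0).1.lieRep θ :=
  (ofCuspForm hφ hφ0).1.hasInfinitesimalCharacter_lieRep_of_forall_hasZCharacter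
    fun _ hψ => hasZCharacter_of_mem_W_ofCuspForm hφ hφ0 hθ hψ

/-- The same as `π.HasInfinitesimalCharacter θ`. [cite: BorelJacquet1979, 4.6] -/
theorem hasInfinitesimalCharacter_ofCuspForm
    (hθ : HasZCharacter (AutomorphyDatum.gl n K hcpt).ofArch φ θ) :
    (ofCuspForm hφ hφ0).1.HasInfinitesimalCharacter θ :=
  (ofCuspForm hφ hφ0).1.hasInfinitesimalCharacter_of_forall_hasZCharacter
    fun _ hψ => hasZCharacter_of_mem_W_ofCuspForm hφ hφ0 hθ hψ

end CuspidalAutomorphicRepData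

end Literature.NumberTheory.Automorphic
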